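import Summits.KontsevichZagierPeriods.Zeta5Search.Barrier.ConeGammaCuspGermDForm

/-!
# ζ(5) search — BARRIER: THE CUSP SLOPE IN EXACT FORM — an oriented integer combination of the member flip times

HONEST FRAMING (cell `pub-zeta5`): systematic search; no irrationality claim unless kernel-certified. MODEL objects
under Brown–Zudilin's (28)+(30) accounting ([BZ22] = arXiv:2210.03391; (28) observed, not proved); nothing here is a
statement about `ζ(5)`, any `γ` of record, the cone's supremum (C2 OPEN) or the VALUE / SIGN of the cusp slope or of
any jump at a named direction (DATA of the cell); S-E stays CONJECTURED; records in print UNMOVED. Prover P2 g27, plan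
(T) (INBOX 2026-08-27 l.9287), companion of `ConeGammaCuspGermDForm`.

`germ_pair_eq_sum_jumps` writes every one-sided germ as `K_b(δ) = Σ_{0<i<n} c_i·(g_{i−1} − g_i)` over a partition
through the member flip points and `0`. This file orients the jumps, constructs the partition and sums over a period:
* **`torusN_sub_oriented_of_flips`** — two small displacements `Δ ≤ Δ'` (memberwise, member forms non-zero) at
  `b ∈ bkpts a T`: `−#(S ∩ F^c) ≤ 𝒩(θ_b + Δ') − 𝒩(θ_b + Δ) ≤ #(S ∩ F)` for any finset `S ⊇` the flipping members — WALL
  ORIENTATION (`torusN_sub_le_oriented`): exactly the flipping floors go up by one;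
* `flip_between_midpoints`, **`germ_jump_oriented`** — along the local line: `−#(S ∩ F^c) ≤ g_i − g_{i−1} ≤ #(S ∩ F)` for
  `S ⊇ {members with flip point c_i}`; a simple flip of an `F`-member has jump `0` or `+1`, of an `F^c`-member `−1`
  or `0`, a point that is no member's flip point has jump `0`;
* **`germ_pair_exists_intComb`** — PARTITION-FREE: for `b ∈ bkpts a T`, `δ` and an admissible scale `η` ALONE there
  are `n`, the canonical chain `−W = c_0 < ⋯ < c_n = W` through all 28 flip points and `0`, and INTEGERS `j_i` with the
  oriented bounds, `Σ_i j_i = 𝒩(θ_b + (ηW)·s) − 𝒩(θ_b − (ηW)·s)` (the orbit jump at `b`) and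
  `germR(δ)(b) + germL(δ)(b) = −Σ_{0<i<n} c_i·j_i = Σ (flip time) × (oriented jump)`;
* `cuspSlope_eq_sum_germ_pairs` — `σ(δ) = Σ_{m<M−1} K_{b_m}(δ)` over the breakpoints `b_0 = 0, …, b_{M−2}` of one period
  (the left germ at `b_{M−1} = T` is the left germ at `0`, `germL_period`);
* **`cuspSlope_eq_neg_intComb`** — THE CUSP SLOPE IN EXACT FORM: `σ(δ) = −Σ_{m<M−1} Σ_{0<i<n_m} c_{m,i}·j_{m,i}` with
  the canonical oriented data of every junction of the period (lattice point included);
* **`intComb_nonneg_of_isLocalMax`** — at a Regular OPEN-box local maximiser of the MODEL `γ` with `Q > 0` (P2 g23's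
  hypotheses, `cuspSlope_nonpos_of_isLocalMax`): `Σ_m Σ_i c_{m,i}·j_{m,i} ≥ 0` in EVERY direction `δ` — the member flip
  times of all junctions, weighted by ORIENTED bounded integers, sum to `≥ 0`.
DESK (DATA, `HOME/pub-zeta5-p2/g27/alg/germform.py`, exact): 0 orientation violations at 22,044 junction × displacement
pairs (record/41, flag/60, argmax-120, t*/480); simple flips of `F`-members `{0, +1}` only, of `F^c`-members `{−1, 0}`
only; the re-summed `S(v)` equals P2 g11's sealed values digit for digit. NOT here (honest): the sign of `σ` or of any
jump at a named direction; anything about `γ` of record, C2, S-E, `ζ(5)`.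
-/

noncomputable section

open Set MeasureTheory
open scoped Topology

namespace Summit.KontsevichZagierPeriods.Zeta5Search.Barrier.ConeGamma

/-! ### Wall orientation for one-sided jumps -/

/-- **ORIENTED ONE-SIDED JUMP between two patterns.** Let `b ∈ bkpts a T` and `Δ, Δ'` two displacements with forms
`< 1` and `< wallDist a T`, whose member forms are non-zero and weakly increase from `Δ` to `Δ'`; let `S` be any finset
containing every member that flips (`φ_k(Δ) < 0 < φ_k(Δ')`). Then
`−#(S ∩ F^c) ≤ 𝒩(θ_b + Δ') − 𝒩(θ_b + Δ) ≤ #(S ∩ F)`: exactly the flipping floors go up by one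
(`torusN_sub_le_oriented` / `oriented_le_torusN_sub`). -/
theorem torusN_sub_oriented_of_flips {a : Dir} {T b : ℝ} (hb : b ∈ bkpts a T) {Δ Δ' : Fin 8 → ℝ}
    (hΔ1 : ∀ k, |phiForm Δ k| < 1) (hΔ2 : ∀ k, |phiForm Δ k| < wallDist a T)
    (hΔ'1 : ∀ k, |phiForm Δ' k| < 1) (hΔ'2 : ∀ k, |phiForm Δ' k| < wallDist a T)
    (hnz : ∀ k, (∃ z : ℤ, b * h28 a k = z) → phiForm Δ k ≠ 0 ∧ phiForm Δ' k ≠ 0)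
    (hle : ∀ k, (∃ z : ℤ, b * h28 a k = z) → phiForm Δ k ≤ phiForm Δ' k)
    {S : Finset (Fin 28)}
    (hS : ∀ k, (∃ z : ℤ, b * h28 a k = z) → phiForm Δ k < 0 → 0 < phiForm Δ' k → k ∈ S) :
    -(((S ∩ FIdxᶜ).card : ℤ)) ≤ torusN (b • sParam a + Δ') - torusN (b • sParam a + Δ) ∧
      torusN (b • sParam a + Δ') - torusN (b • sParam a + Δ) ≤ (S ∩ FIdx).card := by
  have fP := fun k => floor_phiForm_bkpt_add hb hΔ1 hΔ2 k
  have fP' := fun k => floor_phiForm_bkpt_add hb hΔ'1 hΔ'2 k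
  have hpt : ∀ k,
      max (⌊phiForm (b • sParam a + Δ') k⌋ - ⌊phiForm (b • sParam a + Δ) k⌋) 0 ≤ (if k ∈ S then (1 : ℤ) else 0) ∧
      max (⌊phiForm (b • sParam a + Δ) k⌋ - ⌊phiForm (b • sParam a + Δ') k⌋) 0 = 0 := by
    intro k
    have hind : (0 : ℤ) ≤ if k ∈ S then (1 : ℤ) else 0 := by split_ifs <;> norm_num
    by_cases hm : ∃ z : ℤ, b * h28 a k = z
    · obtain ⟨z, hz⟩ := hm
      obtain ⟨hz1, hz2⟩ := hnz k ⟨z, hz⟩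
      rcases lt_or_gt_of_ne hz1 with hneg | hposk
      · have rP : ⌊phiForm (b • sParam a + Δ) k⌋ = z - 1 := (fP k).2.1 z hz hneg
        rcases lt_or_gt_of_ne hz2 with hneg' | hpos'
        · have rP' : ⌊phiForm (b • sParam a + Δ') k⌋ = z - 1 := (fP' k).2.1 z hz hneg'
          rw [rP, rP']; exact ⟨by simp [hind], by simp⟩
        · have rP' : ⌊phiForm (b • sParam a + Δ') k⌋ = z := (fP' k).1 z hz hpos'
          rw [rP, rP', if_pos (hS k ⟨z, hz⟩ hneg hpos')]; exact ⟨by simp, by simp⟩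
      · have hpos' : 0 < phiForm Δ' k := hposk.trans_le (hle k ⟨z, hz⟩)
        rw [(fP k).1 z hz hposk, (fP' k).1 z hz hpos']; exact ⟨by simp [hind], by simp⟩
    · push Not at hm
      rw [(fP k).2.2 hm, (fP' k).2.2 hm]; exact ⟨by simp [hind], by simp⟩
  have hU := torusN_sub_le_oriented (b • sParam a + Δ) (b • sParam a + Δ')
  have hL := oriented_le_torusN_sub (b • sParam a + Δ) (b • sParam a + Δ')
  have b1 : ∀ s : Finset (Fin 28),
      ∑ k ∈ s, max (⌊phiForm (b • sParam a + Δ') k⌋ - ⌊phiForm (b • sParam a + Δ) k⌋) 0 ≤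
        ∑ k ∈ s, (if k ∈ S then (1 : ℤ) else 0) := fun s => Finset.sum_le_sum fun k _ => (hpt k).1
  have z2 : ∀ s : Finset (Fin 28),
      ∑ k ∈ s, max (⌊phiForm (b • sParam a + Δ) k⌋ - ⌊phiForm (b • sParam a + Δ') k⌋) 0 = 0 :=
    fun s => Finset.sum_eq_zero fun k _ => (hpt k).2
  have cF : ∑ k ∈ FIdx, (if k ∈ S then (1 : ℤ) else 0) = ((S ∩ FIdx).card : ℤ) := by
    rw [Finset.sum_boole, Finset.filter_mem_eq_inter, Finset.inter_comm]
  have cFc : ∑ k ∈ FIdxᶜ, (if k ∈ S then (1 : ℤ) else 0) = ((S ∩ FIdxᶜ).card : ℤ) := by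
    rw [Finset.sum_boole, Finset.filter_mem_eq_inter, Finset.inter_comm]
  have := b1 FIdx; have := b1 FIdxᶜ; have := z2 FIdx; have := z2 FIdxᶜ
  constructor <;> linarith

/-! ### The size and orientation of the jumps -/

/-- Between consecutive midpoints only the members with flip point `c_i` change sign, and they go from negative to
positive (`0 < i < n`, partition through the member flip points). -/
theorem flip_between_midpoints {a : Dir} (hpos : ∀ k, 0 < h28 a k) {b : ℝ} (δ : Fin 8 → ℝ) {n : ℕ} {c : ℕ → ℝ}
    (hmono : ∀ j < n, c j < c (j + 1))
    (hflip : ∀ k, (∃ z : ℤ, b * h28 a k = z) → ∃ i ≤ n, c i = -(phiForm δ k / h28 a k))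
    {i : ℕ} (hi0 : 0 < i) (hin : i < n) {k : Fin 28} (hk : ∃ z : ℤ, b * h28 a k = z)
    (hn : (c (i - 1) + c i) / 2 * h28 a k + phiForm δ k < 0) (hp : 0 < (c i + c (i + 1)) / 2 * h28 a k + phiForm δ k) :
    c i = -(phiForm δ k / h28 a k) := by
  have hk0 := hpos k
  have hi1 : i - 1 < n := by omega
  obtain ⟨l, hln, hcl⟩ := hflip k hk
  rw [line_form_eq_mul_sub hk0 hcl] at hn hp
  have hn' : (c (i - 1) + c i) / 2 < c l := by nlinarith
  have hp' : c l < (c i + c (i + 1)) / 2 := by nlinarith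
  have hlt0 : c (i - 1) < c i := by
    have := hmono (i - 1) hi1; rwa [Nat.sub_add_cancel hi0] at this
  have hlt1 : c i < c (i + 1) := hmono i hin
  have hli : i ≤ l := by
    by_contra h
    have := chain_mono hmono (show l ≤ i - 1 by omega) hi1.le
    linarith
  have hil : l ≤ i := by
    by_contra h
    have := chain_mono hmono (show i + 1 ≤ l by omega) hln
    linarith
  rw [le_antisymm hli hil]; exact hcl

/-- **ORIENTED JUMP BOUND.** Under the partition hypotheses, for `0 < i < n` and any finset `S` containing every member
whose flip point is `c_i`: `−#(S ∩ F^c) ≤ g_i − g_{i−1} ≤ #(S ∩ F)` (`g_j = 𝒩(θ_b + η(m_j·s + δ))`): `F`-walls push the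
saving up, `F^c`-walls push it down; a simple flip of an `F`-member has jump `0` or `+1`, of an `F^c`-member `−1` or `0`;
a partition point that is no member's flip point has jump `0`. -/
theorem germ_jump_oriented {a : Dir} (hpos : ∀ k, 0 < h28 a k) {T b : ℝ} (hb : b ∈ bkpts a T)
    (δ : Fin 8 → ℝ) {η : ℝ} (hη : 0 < η) (h1 : η * clusterBound a δ < 1) (h2 : η * clusterBound a δ < wallDist a T)
    {n : ℕ} {c : ℕ → ℝ} (hc0 : c 0 = -clusterWidth a δ) (hcn : c n = clusterWidth a δ)
    (hmono : ∀ j < n, c j < c (j + 1))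
    (hflip : ∀ k, (∃ z : ℤ, b * h28 a k = z) → ∃ i ≤ n, c i = -(phiForm δ k / h28 a k))
    {i : ℕ} (hi0 : 0 < i) (hin : i < n) {S : Finset (Fin 28)}
    (hS : ∀ k, (∃ z : ℤ, b * h28 a k = z) → c i = -(phiForm δ k / h28 a k) → k ∈ S) :
    -(((S ∩ FIdxᶜ).card : ℤ)) ≤
        torusN (b • sParam a + η • (((c i + c (i + 1)) / 2) • sParam a + δ)) -
          torusN (b • sParam a + η • (((c (i - 1) + c i) / 2) • sParam a + δ)) ∧
      torusN (b • sParam a + η • (((c i + c (i + 1)) / 2) • sParam a + δ)) -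
          torusN (b • sParam a + η • (((c (i - 1) + c i) / 2) • sParam a + δ)) ≤ (S ∩ FIdx).card := by
  have hi1 : i - 1 < n := by omega
  have hlt0 : c (i - 1) < c i := by
    have := hmono (i - 1) hi1; rwa [Nat.sub_add_cancel hi0] at this
  have hlt1 : c i < c (i + 1) := hmono i hin
  have hlo : -clusterWidth a δ ≤ c (i - 1) := by rw [← hc0]; exact chain_mono hmono (Nat.zero_le _) hi1.le
  have hhi : c (i + 1) ≤ clusterWidth a δ := by rw [← hcn]; exact chain_mono hmono (Nat.succ_le_of_lt hin) le_rfl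
  have hxI : c (i - 1) < (c (i - 1) + c i) / 2 ∧ (c (i - 1) + c i) / 2 < c (i - 1 + 1) := by
    rw [Nat.sub_add_cancel hi0]; exact ⟨by linarith, by linarith⟩
  have hyI : c i < (c i + c (i + 1)) / 2 ∧ (c i + c (i + 1)) / 2 < c (i + 1) := ⟨by linarith, by linarith⟩
  have hxW : |(c (i - 1) + c i) / 2| ≤ clusterWidth a δ := abs_le.mpr ⟨by linarith, by linarith⟩
  have hyW : |(c i + c (i + 1)) / 2| ≤ clusterWidth a δ := abs_le.mpr ⟨by linarith, by linarith⟩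
  obtain ⟨hx1, hx2⟩ := disp_small hpos δ hη h1 h2 hxW (T := T)
  obtain ⟨hy1, hy2⟩ := disp_small hpos δ hη h1 h2 hyW (T := T)
  have sx := member_signs_on_cell hpos δ hmono hflip hi1 hxI hxI (b := b)
  have sy := member_signs_on_cell hpos δ hmono hflip hin hyI hyI (b := b)
  refine torusN_sub_oriented_of_flips hb hx1 hx2 hy1 hy2 (fun k hk => ?_) (fun k _ => ?_) fun k hk hn hp => ?_
  · rw [phiForm_disp, phiForm_disp]
    exact ⟨mul_ne_zero hη.ne' (by rcases sx k hk with ⟨h, -⟩ | ⟨h, -⟩; exacts [h.ne', h.ne]),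
      mul_ne_zero hη.ne' (by rcases sy k hk with ⟨h, -⟩ | ⟨h, -⟩; exacts [h.ne', h.ne])⟩
  · rw [phiForm_disp, phiForm_disp]
    exact mul_le_mul_of_nonneg_left (by nlinarith [hpos k]) hη.le
  · rw [phiForm_disp] at hn hp
    exact hS k hk (flip_between_midpoints hpos δ hmono hflip hi0 hin hk
      (lt_of_mul_lt_mul_left (by rwa [mul_zero]) hη.le) (lt_of_mul_lt_mul_left (by rwa [mul_zero]) hη.le))

/-! ### The partition-free exact form of the one-sided germ -/

/-- **THE ONE-SIDED GERM IS AN ORIENTED INTEGER COMBINATION OF THE FLIP TIMES — partition-free form.** Let all 28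
forms of `a` be positive, `b ∈ bkpts a T`, `δ` a displacement and `0 < η` with `ηK < 1`, `ηK < wallDist a T`. Then there
are `n`, a chain `−W = c_0 < ⋯ < c_n = W` through all 28 flip points and `0` (interior points among these) and INTEGERS
`j_i` (`0 < i < n`) with: `−#(S ∩ F^c) ≤ j_i ≤ #(S ∩ F)` for every finset `S` containing the members whose flip point is
`c_i`; `Σ_{0<i<n} j_i = 𝒩(θ_b + (ηW)·s) − 𝒩(θ_b − (ηW)·s)` (the orbit jump at `b`); and
`germR(δ)(b) + germL(δ)(b) = −Σ_{0<i<n} c_i · j_i`. -/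
theorem germ_pair_exists_intComb {a : Dir} (hpos : ∀ k, 0 < h28 a k) {T b : ℝ} (hb : b ∈ bkpts a T)
    (δ : Fin 8 → ℝ) {η : ℝ} (hη : 0 < η) (h1 : η * clusterBound a δ < 1) (h2 : η * clusterBound a δ < wallDist a T) :
    ∃ (n : ℕ) (c : ℕ → ℝ) (j : ℕ → ℤ),
      c 0 = -clusterWidth a δ ∧ c n = clusterWidth a δ ∧ (∀ i < n, c i < c (i + 1)) ∧
      (∀ k : Fin 28, ∃ i ≤ n, c i = -(phiForm δ k / h28 a k)) ∧ (∃ i ≤ n, c i = 0) ∧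
      (∀ i, 0 < i → i < n → c i = 0 ∨ ∃ k : Fin 28, c i = -(phiForm δ k / h28 a k)) ∧
      (∀ i, 0 < i → i < n → ∀ S : Finset (Fin 28),
        (∀ k, (∃ z : ℤ, b * h28 a k = z) → c i = -(phiForm δ k / h28 a k) → k ∈ S) →
          -(((S ∩ FIdxᶜ).card : ℤ)) ≤ j i ∧ j i ≤ (S ∩ FIdx).card) ∧
      ∑ i ∈ Finset.Ico 1 n, j i =
        torusN (b • sParam a + (η * clusterWidth a δ) • sParam a) -
          torusN (b • sParam a - (η * clusterWidth a δ) • sParam a) ∧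
      germR a δ η b + germL a δ η b = -∑ i ∈ Finset.Ico 1 n, c i * (j i : ℝ) := by
  classical
  have hW := clusterWidth_pos hpos δ
  -- the canonical chain through the 28 flip points and `0`
  have hin : ∀ k : Fin 28, -clusterWidth a δ < -(phiForm δ k / h28 a k) ∧
      -(phiForm δ k / h28 a k) < clusterWidth a δ := fun k => by
    have h := abs_lt.mp (abs_flip_lt_clusterWidth hpos δ k)
    exact ⟨by linarith [h.2], by linarith [h.1]⟩
  obtain ⟨n, c, hc0, hcn, hmono, hmem, hint⟩ := exists_chain_through
    (insert (0 : ℝ) (Finset.univ.image fun k : Fin 28 => -(phiForm δ k / h28 a k)))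
    (by linarith : -clusterWidth a δ < clusterWidth a δ)
    (fun v hv => by
      rcases Finset.mem_insert.mp hv with rfl | hv
      · linarith
      · obtain ⟨k, -, rfl⟩ := Finset.mem_image.mp hv; exact (hin k).1)
    (fun v hv => by
      rcases Finset.mem_insert.mp hv with rfl | hv
      · exact hW
      · obtain ⟨k, -, rfl⟩ := Finset.mem_image.mp hv; exact (hin k).2)
  have hall : ∀ k : Fin 28, ∃ i ≤ n, c i = -(phiForm δ k / h28 a k) := fun k =>
    hmem _ (Finset.mem_insert_of_mem (Finset.mem_image.mpr ⟨k, Finset.mem_univ _, rfl⟩))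
  have hzero : ∃ i ≤ n, c i = 0 := hmem _ (Finset.mem_insert_self _ _)
  have hn : 0 < n := by
    rcases Nat.eq_zero_or_pos n with h | h
    · rw [h] at hcn; linarith
    · exact h
  -- the line step `t = ηW`
  have ht : 0 < η * clusterWidth a δ := mul_pos hη hW
  have htx : η * clusterWidth a δ * xMax a ≤ η * clusterBound a δ := by
    rw [mul_assoc]; exact mul_le_mul_of_nonneg_left (clusterWidth_mul_xMax_le_clusterBound a δ) hη.le
  set g : ℕ → ℤ := fun i => torusN (b • sParam a + η • (((c i + c (i + 1)) / 2) • sParam a + δ)) with hg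
  refine ⟨n, c, fun i => g i - g (i - 1), hc0, hcn, hmono, hall, hzero, fun i hi0 hi => ?_, fun i hi0 hi S hS => ?_,
    ?_, ?_⟩
  · rcases Finset.mem_insert.mp (hint i hi0 hi) with h | h
    · exact Or.inl h
    · obtain ⟨k, -, hk⟩ := Finset.mem_image.mp h; exact Or.inr ⟨k, hk.symm⟩
  · have h := germ_jump_oriented hpos hb δ hη h1 h2 hc0 hcn hmono (fun k _ => hall k) hi0 hi hS
    rw [hg]; simp only [Nat.sub_add_cancel hi0]; exact h
  · have h := germ_jumps_sum hpos hb δ hη h1 h2 ht (htx.trans_lt h1) (htx.trans_lt h2) hn hc0 hcn hmono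
      fun k _ => hall k
    rw [hg]
    simp only
    rw [← h]
    exact Finset.sum_congr rfl fun i hi => by rw [Nat.sub_add_cancel (Finset.mem_Ico.mp hi).1]
  · rw [germ_pair_eq_sum_jumps hpos hb δ hη h1 h2 ht (htx.trans_lt h1) (htx.trans_lt h2) hn hc0 hcn hmono
      (fun k _ => hall k) hzero, ← Finset.sum_neg_distrib]
    refine Finset.sum_congr rfl fun i hi => ?_
    rw [hg]; simp only [Nat.sub_add_cancel (Finset.mem_Ico.mp hi).1]; push_cast; ring

/-! ### The period: the cusp slope as a sum of one-sided germs, in exact form -/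

/-- **The cusp slope is the sum of the one-sided germs of one period**: at every admissible scale `ρ`,
`cuspSlope a T δ = Σ_{m<M−1} (germR(δ)(b_m) + germL(δ)(b_m))` over the breakpoints `b_0 = 0, …, b_{M−2}` (the left germ at
`b_{M−1} = T` is the left germ at `b_0 = 0` by periodicity, `germL_period`). -/
theorem cuspSlope_eq_sum_germ_pairs {a : Dir} (hpos : ∀ k, 0 < h28 a k) {T : ℝ} (hT : 0 < T)
    (hper : ∀ k : Fin 28, ∃ z : ℤ, T * h28 a k = z) (δ : Fin 8 → ℝ) {ρ : ℝ} (hρ : 0 < ρ)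
    (h1 : ρ * clusterBound a δ < 1) (h2 : ρ * clusterBound a δ < wallDist a T)
    (hgap : ∀ m, m + 1 < (bkpts a T).card → 2 * ρ * clusterWidth a δ ≤ bkpt a T (m + 1) - bkpt a T m) :
    cuspSlope a T δ =
      ∑ m ∈ Finset.range ((bkpts a T).card - 1), (germR a δ ρ (bkpt a T m) + germL a δ ρ (bkpt a T m)) := by
  have hc := two_le_card_bkpts a hT
  rw [cuspSlope_eq_sum_germs hpos hT hper δ hρ h1 h2 hgap, sum_germs_reindex a hT δ ρ, germL_period hper δ ρ,
    show (bkpts a T).card - 1 = (bkpts a T).card - 2 + 1 by omega,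
    Finset.sum_range_succ' (fun m => germR a δ ρ (bkpt a T m) + germL a δ ρ (bkpt a T m)), bkpt_zero a hT]
  ring

/-- **THE CUSP SLOPE IN EXACT FORM.** Under the hypotheses of `cuspSlope_eq_sum_germs` (all 28 forms positive, a period
`T`, ONE admissible scale `ρ` below every breakpoint gap): for every junction `b_m` (`m + 1 < #bkpts`, the lattice
point `b_0 = 0` included) there are canonical data `n_m`, `c_{m,·}` (the chain through the 28 flip points and `0`),
`j_{m,·}` (ORIENTED integer jumps, `−#(S ∩ F^c) ≤ j ≤ #(S ∩ F)` for `S ⊇` the members of `b_m` flipping there, adding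
up to the orbit jump at `b_m`) such that `cuspSlope a T δ = −Σ_{m<M−1} Σ_{0<i<n_m} c_{m,i} · j_{m,i}`: the cusp slope is
an oriented integer combination of the member flip times `φ_k(δ)/h_k(a) = −c`. -/
theorem cuspSlope_eq_neg_intComb {a : Dir} (hpos : ∀ k, 0 < h28 a k) {T : ℝ} (hT : 0 < T)
    (hper : ∀ k : Fin 28, ∃ z : ℤ, T * h28 a k = z) (δ : Fin 8 → ℝ) {ρ : ℝ} (hρ : 0 < ρ)
    (h1 : ρ * clusterBound a δ < 1) (h2 : ρ * clusterBound a δ < wallDist a T)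
    (hgap : ∀ m, m + 1 < (bkpts a T).card → 2 * ρ * clusterWidth a δ ≤ bkpt a T (m + 1) - bkpt a T m) :
    ∃ (n : ℕ → ℕ) (c : ℕ → ℕ → ℝ) (j : ℕ → ℕ → ℤ),
      (∀ m, m + 1 < (bkpts a T).card →
        c m 0 = -clusterWidth a δ ∧ c m (n m) = clusterWidth a δ ∧ (∀ i < n m, c m i < c m (i + 1)) ∧
        (∀ k : Fin 28, ∃ i ≤ n m, c m i = -(phiForm δ k / h28 a k)) ∧ (∃ i ≤ n m, c m i = 0) ∧
        (∀ i, 0 < i → i < n m → c m i = 0 ∨ ∃ k : Fin 28, c m i = -(phiForm δ k / h28 a k)) ∧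
        (∀ i, 0 < i → i < n m → ∀ S : Finset (Fin 28),
          (∀ k, (∃ z : ℤ, bkpt a T m * h28 a k = z) → c m i = -(phiForm δ k / h28 a k) → k ∈ S) →
            -(((S ∩ FIdxᶜ).card : ℤ)) ≤ j m i ∧ j m i ≤ (S ∩ FIdx).card) ∧
        ∑ i ∈ Finset.Ico 1 (n m), j m i =
          torusN (bkpt a T m • sParam a + (ρ * clusterWidth a δ) • sParam a) -
            torusN (bkpt a T m • sParam a - (ρ * clusterWidth a δ) • sParam a)) ∧
      cuspSlope a T δ =
        -∑ m ∈ Finset.range ((bkpts a T).card - 1), ∑ i ∈ Finset.Ico 1 (n m), c m i * (j m i : ℝ) := by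
  classical
  have key : ∀ m : ℕ, ∃ (n : ℕ) (c : ℕ → ℝ) (j : ℕ → ℤ), m + 1 < (bkpts a T).card →
      (c 0 = -clusterWidth a δ ∧ c n = clusterWidth a δ ∧ (∀ i < n, c i < c (i + 1)) ∧
        (∀ k : Fin 28, ∃ i ≤ n, c i = -(phiForm δ k / h28 a k)) ∧ (∃ i ≤ n, c i = 0) ∧
        (∀ i, 0 < i → i < n → c i = 0 ∨ ∃ k : Fin 28, c i = -(phiForm δ k / h28 a k)) ∧
        (∀ i, 0 < i → i < n → ∀ S : Finset (Fin 28),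
          (∀ k, (∃ z : ℤ, bkpt a T m * h28 a k = z) → c i = -(phiForm δ k / h28 a k) → k ∈ S) →
            -(((S ∩ FIdxᶜ).card : ℤ)) ≤ j i ∧ j i ≤ (S ∩ FIdx).card) ∧
        ∑ i ∈ Finset.Ico 1 n, j i =
          torusN (bkpt a T m • sParam a + (ρ * clusterWidth a δ) • sParam a) -
            torusN (bkpt a T m • sParam a - (ρ * clusterWidth a δ) • sParam a)) ∧
      germR a δ ρ (bkpt a T m) + germL a δ ρ (bkpt a T m) = -∑ i ∈ Finset.Ico 1 n, c i * (j i : ℝ) := by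
    intro m
    by_cases hm : m + 1 < (bkpts a T).card
    · obtain ⟨n, c, j, hc0, hcn, hmono, hall, hzero, hint, hj, hsum, hK⟩ :=
        germ_pair_exists_intComb hpos (bkpt_mem (by omega : m < (bkpts a T).card)) δ hρ h1 h2
      exact ⟨n, c, j, fun _ => ⟨⟨hc0, hcn, hmono, hall, hzero, hint, hj, hsum⟩, hK⟩⟩
    · exact ⟨0, fun _ => 0, fun _ => 0, fun h => absurd h hm⟩
  choose n c j hspec using key
  refine ⟨n, c, j, fun m hm => (hspec m hm).1, ?_⟩
  rw [cuspSlope_eq_sum_germ_pairs hpos hT hper δ hρ h1 h2 hgap, ← Finset.sum_neg_distrib]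
  exact Finset.sum_congr rfl fun m hm => (hspec m (by have := Finset.mem_range.mp hm; omega)).2

/-- **AT A LOCAL MAXIMISER OF THE MODEL `γ` THE ORIENTED COMBINATION IS `≥ 0` IN EVERY DIRECTION.** At a Regular
OPEN-box direction with a period `T` and `Q = C₁ + δ₂₈ − Φ > 0` which is a local maximiser of `γ` (P2 g23's hypotheses;
`cuspSlope_nonpos_of_isLocalMax`: `σ(δ) ≤ 0`), for every displacement `δ` and admissible scale `ρ`: with the canonical
data of `cuspSlope_eq_neg_intComb`, `0 ≤ Σ_{m<M−1} Σ_{0<i<n_m} c_{m,i} · j_{m,i}`. A necessary condition, not a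
location; the sign of `σ` at any named direction stays DATA. -/
theorem intComb_nonneg_of_isLocalMax {a : Dir}
    (hopen : ∀ j : Fin 7, 0 < sParam a j.succ ∧ sParam a j.succ < sParam a 0)
    {T : ℝ} (hT : 0 < T) (hper : ∀ k : Fin 28, ∃ z : ℤ, T * h28 a k = z) (δ : Fin 8 → ℝ)
    (hQ : 0 < C1 a + delta28 a - phi30 a) (hreg : Regular a) (hmax : IsLocalMax gamma a) {ρ : ℝ} (hρ : 0 < ρ)
    (h1 : ρ * clusterBound a δ < 1) (h2 : ρ * clusterBound a δ < wallDist a T)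
    (hgap : ∀ m, m + 1 < (bkpts a T).card → 2 * ρ * clusterWidth a δ ≤ bkpt a T (m + 1) - bkpt a T m) :
    ∃ (n : ℕ → ℕ) (c : ℕ → ℕ → ℝ) (j : ℕ → ℕ → ℤ),
      (∀ m, m + 1 < (bkpts a T).card →
        c m 0 = -clusterWidth a δ ∧ c m (n m) = clusterWidth a δ ∧ (∀ i < n m, c m i < c m (i + 1)) ∧
        (∀ k : Fin 28, ∃ i ≤ n m, c m i = -(phiForm δ k / h28 a k)) ∧ (∃ i ≤ n m, c m i = 0) ∧
        (∀ i, 0 < i → i < n m → c m i = 0 ∨ ∃ k : Fin 28, c m i = -(phiForm δ k / h28 a k)) ∧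
        (∀ i, 0 < i → i < n m → ∀ S : Finset (Fin 28),
          (∀ k, (∃ z : ℤ, bkpt a T m * h28 a k = z) → c m i = -(phiForm δ k / h28 a k) → k ∈ S) →
            -(((S ∩ FIdxᶜ).card : ℤ)) ≤ j m i ∧ j m i ≤ (S ∩ FIdx).card) ∧
        ∑ i ∈ Finset.Ico 1 (n m), j m i =
          torusN (bkpt a T m • sParam a + (ρ * clusterWidth a δ) • sParam a) -
            torusN (bkpt a T m • sParam a - (ρ * clusterWidth a δ) • sParam a)) ∧
      0 ≤ ∑ m ∈ Finset.range ((bkpts a T).card - 1), ∑ i ∈ Finset.Ico 1 (n m), c m i * (j m i : ℝ) := by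
  have hpos := h28_pos_of_openBox hopen
  obtain ⟨n, c, j, hdata, heq⟩ := cuspSlope_eq_neg_intComb hpos hT hper δ hρ h1 h2 hgap
  have s1 := cuspSlope_nonpos_of_isLocalMax hopen hT hper δ hQ hreg hmax
  exact ⟨n, c, j, hdata, by linarith⟩

end Summit.KontsevichZagierPeriods.Zeta5Search.Barrier.ConeGamma

end
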